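import Mathlib
import Summits.Ventures.PercRepro2.Defs
import Summits.Ventures.PercRepro2.Independence
import Summits.Ventures.PercRepro2.Harris
import Summits.Ventures.PercRepro2.Graph
import Summits.Ventures.PercRepro2.Exploration
import Summits.Ventures.PercRepro2.Events
import Summits.Ventures.PercRepro2.FourFunctions
import Summits.Ventures.PercRepro2.Induced
import Summits.Ventures.PercRepro2.Frontier
import Summits.Ventures.PercRepro2.ObsIndependence
import Summits.Ventures.PercRepro2.BHK
import Summits.Ventures.PercRepro2.BHKEvents
import Summits.Ventures.PercRepro2.SideAgreement
import Summits.Ventures.PercRepro2.VdBKahn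
import Summits.Ventures.PercRepro2.BHKAvoid
import Summits.Ventures.PercRepro2.R2PrimeThreeReduction
import Summits.Ventures.PercRepro2.YBridge
import Summits.Ventures.PercRepro2.Yu1Functionals
import Summits.Ventures.PercRepro2.Yu1Events
import Summits.Ventures.PercRepro2.Yu1
import Summits.Ventures.PercRepro2.LBSplit
import Summits.Ventures.PercRepro2.YDelta
import Summits.Ventures.PercRepro2.SD
import Summits.Ventures.PercRepro2.Threshold
import Summits.Ventures.PercRepro2.Lambda
import Summits.Ventures.PercRepro2.LambdaTau
import Summits.Ventures.PercRepro2.LambdaSlack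
import Summits.Ventures.PercRepro2.HF2
import Summits.Ventures.PercRepro2.Yu2
import Summits.Ventures.PercRepro2.N0
import Summits.Ventures.PercRepro2.Y
import Summits.Ventures.PercRepro2.YDeltaTools
import Summits.Ventures.PercRepro2.ZDelta
import Summits.Ventures.PercRepro2.ZExpand
import Summits.Ventures.PercRepro2.ISplit
import Summits.Ventures.PercRepro2.MRl
import Summits.Ventures.PercRepro2.ZOloc
import Summits.Ventures.PercRepro2.SideBridge
import Summits.Ventures.PercRepro2.HCov
import Summits.Ventures.PercRepro2.BasePrime
import Summits.Ventures.PercRepro2.PendantRoot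
import Summits.Ventures.PercRepro2.PendantO

/-!
# The pendant-at-`b` identity (blind cell PercRepro2, typer-1; mine-a g2 `MINEA-LOCALSUPER.md` §13
FACT C "x = b", INBOX 2026-08-23T09:38:10Z; lead g11 ruling 09:56:39Z: "the b-attachment identity as a
Lean IDENTITY — its sign is the open 4-marker statement")

With `a₃` a leaf attached to `b` by the edge `f` of weight `q`, `a₃ ∈ C(a_i)` iff `f` is open and
`b ∈ C(a_i)`, so the atoms of `Gc` are `a₃`-free masses up to factors `q` (the lemmas of `PendantO`
with the attachment vertex `b`). In the cleared `a₃`-free coordinates under `Q`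
(`Sb = P(Q,bL) − P(Q,bH)`, `So`, `mbU = P(Q,bL) + P(Q,bH)`, `moU`, `Sig = P(Q, o ∈ U, b ∈ U)`,
`Ebo = P(Q, bL, oU) − P(Q, bH, oU)`, `EQbo = E[σ_b σ_o; Q]`, `CovC = P(Q)·EQbo − Sb·So`):

* **`Gc_pendant_b`**: `Gc = CovC (P − q mbU) − (1−q)(P² Sig − P moU mbU) + q (moU − qSig)(P mbU − Sb²)
  − q (P − q mbU)(P Sig − Sb Ebo)` — the cleared form of mine-a's
  `G = P′(Q)[T₀ + qA + q²B]/(1 − qβ)` (`D = P(Q)(1 − qβ)`); the sign of the right-hand side is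
  the OPEN 4-marker statement `PendantB.Row` (census 0 negatives / 105, mine-a).
-/

namespace Summit.Ventures.PercRepro2

open UnionCluster CovForm PendantRoot PendantO

namespace PendantB

variable {V : Type*} {E : Type*} [Fintype E] [DecidableEq E] {R : Type*} [Field R]
  [LinearOrder R] [IsStrictOrderedRing R]

section Shapes

variable {ends : E → Sym2 V}

omit [Fintype E] [DecidableEq E] in
/-- A repeated factor is absorbed. -/
lemma Q_inter_absorb (Q X Y : Set (Config E)) : Q ∩ (X ∩ (Y ∩ X)) = Q ∩ (Y ∩ X) := by
  ext ω; simp only [Set.mem_inter_iff]; tauto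

omit [Fintype E] [DecidableEq E] in
/-- Under `Q`, `b` is not in both root clusters (the `b`-factor last). -/
lemma Q_inter_both_last (ends : E → Sym2 V) (a₁ a₂ b : V) (Y : Set (Config E)) :
    avoidAll ends a₂ {a₁} ∩ (connEvent ends a₁ b ∩ (Y ∩ connEvent ends a₂ b)) = ∅ := by
  have := Q_inter_both_eq_empty ends a₁ a₂ b Y
  rw [← this]
  ext ω; simp only [Set.mem_inter_iff]; tauto

omit [Fintype E] [DecidableEq E] in
/-- Under `Q`, `b` is not in both root clusters (the `b`-factor last, other order). -/
lemma Q_inter_both_last' (ends : E → Sym2 V) (a₁ a₂ b : V) (Y : Set (Config E)) :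
    avoidAll ends a₂ {a₁} ∩ (connEvent ends a₂ b ∩ (Y ∩ connEvent ends a₁ b)) = ∅ := by
  have := Q_inter_both_eq_empty ends a₁ a₂ b Y
  rw [← this]
  ext ω; simp only [Set.mem_inter_iff]; tauto

omit [Fintype E] [DecidableEq E] in
/-- The canonical order `o`-event first. -/
lemma Q_inter_swap (Q X Y : Set (Config E)) : Q ∩ (X ∩ Y) = Q ∩ (Y ∩ X) := by
  rw [Set.inter_comm X Y]

end Shapes

section Main

variable (p : E → R) (ends : E → Sym2 V)

/-- **mine-a's pendant-at-`b` identity** (cleared). With `P = P(Q)`, `q = p f` and the `a₃`-free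
masses `m(X) = P(Q ∩ X)`:
`Gc = CovC·(P − q·mbU) − (1 − q)·(P²·Sig − P·moU·mbU) + q·(moU − q·Sig)·(P·mbU − Sb²) − q·(P − q·mbU)·(P·Sig − Sb·Ebo)`. -/
theorem Gc_pendant_b {f : E} {a₃ b : V} (hf : ends f = s(a₃, b))
    (hleaf : ∀ e, a₃ ∈ ends e → e = f) (h3b : a₃ ≠ b) {o a₁ a₂ : V} (h31 : a₃ ≠ a₁)
    (h32 : a₃ ≠ a₂) (ho : o ≠ a₃) :
    let Q := avoidAll ends a₂ {a₁}
    let P := prob p Q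
    let q := p f
    let bL := prob p (Q ∩ connEvent ends a₁ b)
    let bH := prob p (Q ∩ connEvent ends a₂ b)
    let oL := prob p (Q ∩ connEvent ends a₁ o)
    let oH := prob p (Q ∩ connEvent ends a₂ o)
    let A := prob p (Q ∩ (connEvent ends a₁ o ∩ connEvent ends a₁ b))
    let B := prob p (Q ∩ (connEvent ends a₂ o ∩ connEvent ends a₂ b))
    let C := prob p (Q ∩ (connEvent ends a₂ o ∩ connEvent ends a₁ b))
    let Dd := prob p (Q ∩ (connEvent ends a₁ o ∩ connEvent ends a₂ b))
    let Sb := bL - bH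
    let So := oL - oH
    let mbU := bL + bH
    let moU := oL + oH
    let Sig := A + B + C + Dd
    let Ebo := (A + C) - (Dd + B)
    let EQbo := A + B - C - Dd
    let CovC := P * EQbo - Sb * So
    Gc p ends o a₁ a₂ a₃ b =
      CovC * (P - q * mbU) - (1 - q) * (P ^ 2 * Sig - P * moU * mbU) +
        q * (moU - q * Sig) * (P * mbU - Sb ^ 2) - q * (P - q * mbU) * (P * Sig - Sb * Ebo) := by
  intro Q P q bL bH oL oH A B C Dd Sb So mbU moU Sig Ebo EQbo CovC
  have hb : b ≠ a₃ := Ne.symm h3b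
  have c₁o := free_connEvent hf hleaf h3b (Ne.symm h31) ho
  have c₂o := free_connEvent hf hleaf h3b (Ne.symm h32) ho
  have c₁b := free_connEvent hf hleaf h3b (Ne.symm h31) hb
  have c₂b := free_connEvent hf hleaf h3b (Ne.symm h32) hb
  simp only [Q, P, q, bL, bH, oL, oH, A, B, C, Dd, Sb, So, mbU, moU, Sig, Ebo, EQbo, CovC]
  unfold Gc DEF CovForm.EQbo EQb3 EQb3o EQo EQ3 EQ3o PDb PDbo Do
  rw [gap_eq_Q]
  simp only [prob_PD_o p hf hleaf h3b h31 h32, prob_T_o p hf hleaf h3b h31 h32,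
    prob_T'_o p hf hleaf h3b h31 h32,
    prob_PD_inter_o p hf hleaf h3b h31 h32 c₁b, prob_PD_inter_o p hf hleaf h3b h31 h32 c₂b,
    prob_PD_inter_o p hf hleaf h3b h31 h32 c₁o, prob_PD_inter_o p hf hleaf h3b h31 h32 c₂o,
    prob_PD_inter_o p hf hleaf h3b h31 h32 (c₁o.inter c₁b),
    prob_PD_inter_o p hf hleaf h3b h31 h32 (c₂o.inter c₁b),
    prob_PD_inter_o p hf hleaf h3b h31 h32 (c₁o.inter c₂b),
    prob_PD_inter_o p hf hleaf h3b h31 h32 (c₂o.inter c₂b),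
    prob_T_inter_o p hf hleaf h3b h31 h32 c₁b, prob_T_inter_o p hf hleaf h3b h31 h32 c₂b,
    prob_T_inter_o p hf hleaf h3b h31 h32 c₁o, prob_T_inter_o p hf hleaf h3b h31 h32 c₂o,
    prob_T_inter_o p hf hleaf h3b h31 h32 (c₁o.inter c₁b),
    prob_T_inter_o p hf hleaf h3b h31 h32 (c₂o.inter c₁b),
    prob_T_inter_o p hf hleaf h3b h31 h32 (c₁o.inter c₂b),
    prob_T_inter_o p hf hleaf h3b h31 h32 (c₂o.inter c₂b),
    prob_T'_inter_o p hf hleaf h3b h31 h32 c₁b, prob_T'_inter_o p hf hleaf h3b h31 h32 c₂b,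
    prob_T'_inter_o p hf hleaf h3b h31 h32 c₁o, prob_T'_inter_o p hf hleaf h3b h31 h32 c₂o,
    prob_T'_inter_o p hf hleaf h3b h31 h32 (c₁o.inter c₁b),
    prob_T'_inter_o p hf hleaf h3b h31 h32 (c₂o.inter c₁b),
    prob_T'_inter_o p hf hleaf h3b h31 h32 (c₁o.inter c₂b),
    prob_T'_inter_o p hf hleaf h3b h31 h32 (c₂o.inter c₂b),
    Q_inter_absorb, Q_inter_both_eq_empty₂, Q_inter_both_eq_empty₂', Q_inter_both_last,
    Q_inter_both_last',
    prob_empty, Set.inter_self,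
    Q_inter_swap (avoidAll ends a₂ {a₁}) (connEvent ends a₁ b) (connEvent ends a₁ o),
    Q_inter_swap (avoidAll ends a₂ {a₁}) (connEvent ends a₁ b) (connEvent ends a₂ o),
    Q_inter_swap (avoidAll ends a₂ {a₁}) (connEvent ends a₂ b) (connEvent ends a₁ o),
    Q_inter_swap (avoidAll ends a₂ {a₁}) (connEvent ends a₂ b) (connEvent ends a₂ o)]
  ring

/-- **The open pendant-at-`b` statement** (mine-a's 4-marker row, census 0 / 105): the cleared
`a₃`-free cubic of `Gc_pendant_b` is nonnegative — equivalently (HCOV) on every instance whose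
`a₃` is a leaf at `b`. -/
def Row (a₁ a₂ o b : V) (q : R) : Prop :=
  let Q := avoidAll ends a₂ {a₁}
  let P := prob p Q
  let bL := prob p (Q ∩ connEvent ends a₁ b)
  let bH := prob p (Q ∩ connEvent ends a₂ b)
  let oL := prob p (Q ∩ connEvent ends a₁ o)
  let oH := prob p (Q ∩ connEvent ends a₂ o)
  let A := prob p (Q ∩ (connEvent ends a₁ o ∩ connEvent ends a₁ b))
  let B := prob p (Q ∩ (connEvent ends a₂ o ∩ connEvent ends a₂ b))
  let C := prob p (Q ∩ (connEvent ends a₂ o ∩ connEvent ends a₁ b))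
  let Dd := prob p (Q ∩ (connEvent ends a₁ o ∩ connEvent ends a₂ b))
  let Sb := bL - bH
  let So := oL - oH
  let mbU := bL + bH
  let moU := oL + oH
  let Sig := A + B + C + Dd
  let Ebo := (A + C) - (Dd + B)
  let EQbo := A + B - C - Dd
  let CovC := P * EQbo - Sb * So
  0 ≤ CovC * (P - q * mbU) - (1 - q) * (P ^ 2 * Sig - P * moU * mbU) +
      q * (moU - q * Sig) * (P * mbU - Sb ^ 2) - q * (P - q * mbU) * (P * Sig - Sb * Ebo)

/-- (HCOV) at a pendant `a₃` attached to `b` is exactly `Row` at `q = p f`. -/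
theorem HCov_pendant_b_iff {f : E} {a₃ b : V} (hf : ends f = s(a₃, b))
    (hleaf : ∀ e, a₃ ∈ ends e → e = f) (h3b : a₃ ≠ b) {o a₁ a₂ : V} (h31 : a₃ ≠ a₁)
    (h32 : a₃ ≠ a₂) (ho : o ≠ a₃) :
    HCov p ends o a₁ a₂ a₃ b ↔ Row p ends a₁ a₂ o b (p f) := by
  unfold HCov Row
  rw [Gc_pendant_b p ends hf hleaf h3b h31 h32 ho]

end Main

end PendantB

end Summit.Ventures.PercRepro2
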